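import Summits.BirchSwinnertonDyer.Rank1Residual.X11b.ProcyclicDescent
import HarnessLib

/-!
# X11b, route R1 — PROCYCLIC DESCENT (c): the engine for an ARBITRARY `κ₀ : G → ℤ_p`
# (image `p^a ℤ_p` rescaled to `ℤ_p`, or image `0`), toward the local step of atom (L10)

HONEST FRAMING (cell `b2b-bsdres`, run/shared/lean/b2b/bsd-rank1-residual/, verbatim in every
file): the goal of the cell is to DELETE the COMBINATION-SHAPED residual classes of the
Birch–Swinnerton-Dyer formula for ALL analytic-rank `≤ 1` elliptic curves over `ℚ` — "full BSD
formula for every rank `≤ 1` curve in class `C`" assembled STRICTLY from published theorems — so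
that the rank-`≤ 1` remainder becomes exactly the CONSTRUCTION-SHAPED classes, which are TYPED
(missing-input `Prop`s), NOT attempted. This is not "finishing BSD". Sub-cell
`b2b-bsdres-multr1-p1` (X11b, route R1 = Castella 2018 Thm. A re-proved along the author's
erratum); a RESEARCH ROUTE; no claim beyond the stated class; X11b stays CONSTRUCTION-SHAPED;
nothing here changes a label; no named fact is minted (two auxiliary definitions with bodies and
theorems; no `sorry`).

## What this file does

`ProcyclicDescent.exists_resSubgroup_eq_of_conjH1_eq` ((a): `res : H¹(G, A) ↠ H¹(ker κ, A)^{γ}`)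
assumes `κ : G ↠ ℤ_p` SURJECTIVE with `κ γ = 1`.  At a decomposition group `D_v ≤ Γ_K` the
restriction of the anticyclotomic character `κ` has image a CLOSED subgroup of `ℤ_p`, i.e. `0` or
`p^a ℤ_p` (`v` split completely / finitely decomposed in `K_∞`).  This file removes the hypothesis:

* `imageIdeal κ₀` — the image of a continuous `κ₀ : G → ℤ_p` (`G` compact) is an ideal of `ℤ_p`
  (closed under `ℤ_p`-multiples by density of `ℕ` and closedness), hence `= 0` or `= (p^a)`
  (`imageIdeal_eq_bot_or`);
* `rescale κ₀ a` — for `κ₀(G) = p^a ℤ_p`, the continuous homomorphism `p^{-a} κ₀ : G ↠ ℤ_p` with the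
  same kernel (`rescale_surjective`, `kerK_rescale`);
* **`exists_resSubgroup_eq_of_forall_conjH1_eq`** — for ANY continuous `κ₀ : G → ℤ_p` on a profinite
  `G` and a `p`-primary discrete `G`-module `A`: a class of `H¹(ker κ₀, A)` fixed by `conj_g` for
  every `g ∈ G` is a restriction from `H¹(G, A)` (case `κ₀ = 0`: `ker κ₀ = G`; otherwise (a) for
  `rescale κ₀ a` and a `γ₀` with `κ₀ γ₀ = p^a`).

References: [JetchevSkinnerWan2017] Lemma 3.3.3 (arXiv:1512.06894 p. 12: "the maps
`H¹(K_w, W) → H¹(K_w, M)^Γ` are surjective"); [SerreGaloisCohomology1997] I §2.6 (b);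
[Washington1997] §13.1 (closed subgroups of `ℤ_p`).
-/

noncomputable section

open CategoryTheory Function
open Literature.NumberTheory.GaloisRepresentations Literature.NumberTheory.EllipticCurves

universe u

namespace Summit.BirchSwinnertonDyer.Rank1Residual.X11b.ProcyclicDescent

/-! ## 1. The image of `κ₀ : G → ℤ_p` is an ideal: `0` or `p^a ℤ_p` -/

section Image

variable {G : Type u} [Group G] [TopologicalSpace G] [CompactSpace G]
variable {p : ℕ} [Fact p.Prime] (κ₀ : G →ₜ* Multiplicative ℤ_[p])

/-- The image of `κ₀` is closed (continuous image of a compact group). [folklore] -/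
theorem isClosed_setOf_exists_eq : IsClosed {x : ℤ_[p] | ∃ g : G, (κ₀ g).toAdd = x} := by
  have e : {x : ℤ_[p] | ∃ g : G, (κ₀ g).toAdd = x} = Set.range (fun g : G ↦ (κ₀ g).toAdd) := by
    ext x; simp
  rw [e]
  exact (isCompact_range (continuous_toAdd.comp κ₀.continuous)).isClosed

/-- **The image `κ₀(G) ⊆ ℤ_p` as an ideal of `ℤ_p`**: a closed subgroup of `ℤ_p` is a
`ℤ_p`-submodule (`ℕ` is dense in `ℤ_p` and `n · κ₀(g) = κ₀(gⁿ)`). [cite: Washington1997, §13.1] -/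
def imageIdeal : Ideal ℤ_[p] where
  carrier := {x : ℤ_[p] | ∃ g : G, (κ₀ g).toAdd = x}
  zero_mem' := ⟨1, by rw [map_one, toAdd_one]⟩
  add_mem' := by
    rintro _ _ ⟨g, rfl⟩ ⟨h, rfl⟩
    exact ⟨g * h, by rw [map_mul, toAdd_mul]⟩
  smul_mem' := by
    rintro c _ ⟨g, rfl⟩
    have hclosed : IsClosed {c : ℤ_[p] | c • (κ₀ g).toAdd ∈
        {x : ℤ_[p] | ∃ g : G, (κ₀ g).toAdd = x}} :=
      (isClosed_setOf_exists_eq κ₀).preimage (continuous_id.smul continuous_const)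
    refine PadicInt.denseRange_natCast.induction_on c hclosed fun n ↦ ?_
    exact ⟨g ^ n, by rw [map_pow, toAdd_pow, smul_eq_mul, nsmul_eq_mul]⟩

/-- Membership in `imageIdeal`. [folklore] -/
theorem mem_imageIdeal_iff (x : ℤ_[p]) : x ∈ imageIdeal κ₀ ↔ ∃ g : G, (κ₀ g).toAdd = x := Iff.rfl

/-- `κ₀ g ∈ imageIdeal κ₀`. [folklore] -/
theorem toAdd_mem_imageIdeal (g : G) : (κ₀ g).toAdd ∈ imageIdeal κ₀ := ⟨g, rfl⟩

/-- **`κ₀(G) = 0` or `κ₀(G) = p^a ℤ_p`** (the non-zero ideals of `ℤ_p` are the `(p^a)`,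
`PadicInt.ideal_eq_span_pow_p`): either `κ₀` is trivial, or some `γ₀` has `κ₀ γ₀ = p^a` and `p^a`
divides every value. [cite: Washington1997, §13.1] -/
theorem imageIdeal_eq_bot_or :
    (∀ g : G, κ₀ g = 1) ∨ ∃ (a : ℕ) (γ₀ : G), (κ₀ γ₀).toAdd = (p : ℤ_[p]) ^ a ∧
      ∀ g : G, (p : ℤ_[p]) ^ a ∣ (κ₀ g).toAdd := by
  by_cases hI : imageIdeal κ₀ = ⊥
  · refine Or.inl fun g ↦ ?_
    have h := toAdd_mem_imageIdeal κ₀ g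
    rw [hI, Ideal.mem_bot] at h
    exact Multiplicative.toAdd.injective (by rw [h, toAdd_one])
  · obtain ⟨a, ha⟩ := PadicInt.ideal_eq_span_pow_p hI
    refine Or.inr ⟨a, ?_⟩
    have hmem : (p : ℤ_[p]) ^ a ∈ imageIdeal κ₀ := by rw [ha]; exact Ideal.mem_span_singleton_self _
    obtain ⟨γ₀, hγ₀⟩ := hmem
    refine ⟨γ₀, hγ₀, fun g ↦ ?_⟩
    have h := toAdd_mem_imageIdeal κ₀ g
    rw [ha, Ideal.mem_span_singleton] at h
    exact h

end Image

/-! ## 2. Rescaling `κ₀` with image `p^a ℤ_p` to a surjection onto `ℤ_p` -/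

section Rescale

variable {G : Type u} [Group G] [TopologicalSpace G]
variable {p : ℕ} [Fact p.Prime] (κ₀ : G →ₜ* Multiplicative ℤ_[p]) (a : ℕ)

/-- `(p^a c) · p^{-a} = c` in `ℚ_p`. [folklore] -/
theorem coe_mul_zpow_neg_of_eq (x c : ℤ_[p]) (h : x = (p : ℤ_[p]) ^ a * c) :
    (x : ℚ_[p]) * (p : ℚ_[p]) ^ (-(a : ℤ)) = c := by
  have hp : (p : ℚ_[p]) ≠ 0 := Nat.cast_ne_zero.mpr (Fact.out : p.Prime).ne_zero
  rw [h, PadicInt.coe_mul, PadicInt.coe_pow, PadicInt.coe_natCast, zpow_neg, zpow_natCast,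
    mul_comm ((p : ℚ_[p]) ^ a) (c : ℚ_[p]), mul_assoc, mul_inv_cancel₀ (pow_ne_zero _ hp), mul_one]

/-- The value `p^{-a} κ₀(g)` has norm `≤ 1`. [folklore] -/
theorem norm_rescale_le (hdiv : ∀ g : G, (p : ℤ_[p]) ^ a ∣ (κ₀ g).toAdd) (g : G) :
    ‖((κ₀ g).toAdd : ℚ_[p]) * (p : ℚ_[p]) ^ (-(a : ℤ))‖ ≤ 1 := by
  obtain ⟨c, hc⟩ := hdiv g
  rw [coe_mul_zpow_neg_of_eq a _ c hc]
  exact c.2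

/-- **`rescale κ₀ a = p^{-a} κ₀ : G →ₜ* ℤ_p`** (for `p^a ∣ κ₀(g)` for all `g`): continuous because
`x ↦ x · p^{-a}` is continuous on `ℚ_p`. [cite: Washington1997, §13.1] -/
def rescale (hdiv : ∀ g : G, (p : ℤ_[p]) ^ a ∣ (κ₀ g).toAdd) : G →ₜ* Multiplicative ℤ_[p] where
  toFun g := Multiplicative.ofAdd ⟨((κ₀ g).toAdd : ℚ_[p]) * (p : ℚ_[p]) ^ (-(a : ℤ)),
    norm_rescale_le κ₀ a hdiv g⟩
  map_one' := by
    apply Multiplicative.toAdd.injective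
    rw [toAdd_ofAdd, toAdd_one]
    apply Subtype.ext
    change ((κ₀ 1).toAdd : ℚ_[p]) * (p : ℚ_[p]) ^ (-(a : ℤ)) = ((0 : ℤ_[p]) : ℚ_[p])
    rw [map_one, toAdd_one, PadicInt.coe_zero, zero_mul]
  map_mul' g h := by
    apply Multiplicative.toAdd.injective
    rw [toAdd_ofAdd, toAdd_mul, toAdd_ofAdd, toAdd_ofAdd]
    apply Subtype.ext
    change ((κ₀ (g * h)).toAdd : ℚ_[p]) * (p : ℚ_[p]) ^ (-(a : ℤ)) =
      (((κ₀ g).toAdd : ℚ_[p]) * (p : ℚ_[p]) ^ (-(a : ℤ))) +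
        (((κ₀ h).toAdd : ℚ_[p]) * (p : ℚ_[p]) ^ (-(a : ℤ)))
    rw [map_mul, toAdd_mul, PadicInt.coe_add, add_mul]
  continuous_toFun := by
    apply continuous_ofAdd.comp
    exact ((continuous_subtype_val.comp (continuous_toAdd.comp κ₀.continuous)).mul
      continuous_const).subtype_mk _

/-- Unfolding `rescale` in `ℚ_p`: `rescale κ₀ a g = κ₀(g) · p^{-a}`. [folklore] -/
theorem coe_toAdd_rescale (hdiv : ∀ g : G, (p : ℤ_[p]) ^ a ∣ (κ₀ g).toAdd) (g : G) :
    (((rescale κ₀ a hdiv g).toAdd : ℤ_[p]) : ℚ_[p]) =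
      ((κ₀ g).toAdd : ℚ_[p]) * (p : ℚ_[p]) ^ (-(a : ℤ)) :=
  rfl

/-- `κ₀(g) = p^a c ⟹ rescale κ₀ a g = c`. [folklore] -/
theorem rescale_eq_of_eq (hdiv : ∀ g : G, (p : ℤ_[p]) ^ a ∣ (κ₀ g).toAdd) (g : G) (c : ℤ_[p])
    (h : (κ₀ g).toAdd = (p : ℤ_[p]) ^ a * c) :
    rescale κ₀ a hdiv g = Multiplicative.ofAdd c := by
  apply Multiplicative.toAdd.injective
  rw [toAdd_ofAdd]
  apply Subtype.ext
  rw [coe_toAdd_rescale, coe_mul_zpow_neg_of_eq a _ c h]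

/-- `κ₀(γ₀) = p^a ⟹ rescale κ₀ a γ₀ = 1`. [folklore] -/
theorem rescale_eq_one (hdiv : ∀ g : G, (p : ℤ_[p]) ^ a ∣ (κ₀ g).toAdd) (γ₀ : G)
    (h : (κ₀ γ₀).toAdd = (p : ℤ_[p]) ^ a) :
    rescale κ₀ a hdiv γ₀ = Multiplicative.ofAdd 1 :=
  rescale_eq_of_eq κ₀ a hdiv γ₀ 1 (by rw [h, mul_one])

/-- **`ker (rescale κ₀ a) = ker κ₀`.** [folklore] -/
theorem kerK_rescale (hdiv : ∀ g : G, (p : ℤ_[p]) ^ a ∣ (κ₀ g).toAdd) :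
    kerK (rescale κ₀ a hdiv) = kerK κ₀ := by
  ext g
  rw [MonoidHom.mem_ker, MonoidHom.mem_ker]
  change rescale κ₀ a hdiv g = 1 ↔ κ₀ g = 1
  obtain ⟨c, hc⟩ := hdiv g
  rw [rescale_eq_of_eq κ₀ a hdiv g c hc]
  have hp : (p : ℤ_[p]) ^ a ≠ 0 := pow_ne_zero _ (Nat.cast_ne_zero.mpr (Fact.out : p.Prime).ne_zero)
  constructor
  · intro h
    have hc0 : c = 0 := by
      have := congrArg Multiplicative.toAdd h
      rwa [toAdd_ofAdd, toAdd_one] at this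
    apply Multiplicative.toAdd.injective
    rw [hc, hc0, mul_zero, toAdd_one]
  · intro h
    rw [h, toAdd_one] at hc
    have hc0 : c = 0 := by
      rcases mul_eq_zero.mp hc.symm with h' | h'
      · exact (hp h').elim
      · exact h'
    rw [hc0]; rfl

/-- **`rescale κ₀ a` is onto `ℤ_p`** when `G` is compact and `κ₀ γ₀ = p^a` for some `γ₀`: the image
is closed and contains `ℕ = {rescale (γ₀ⁿ)}`, which is dense. [cite: Washington1997, §13.1] -/
theorem rescale_surjective [CompactSpace G] (hdiv : ∀ g : G, (p : ℤ_[p]) ^ a ∣ (κ₀ g).toAdd)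
    (γ₀ : G) (h : (κ₀ γ₀).toAdd = (p : ℤ_[p]) ^ a) :
    Surjective (rescale κ₀ a hdiv) := by
  intro y
  have hclosed : IsClosed (Set.range fun g : G ↦ (rescale κ₀ a hdiv g).toAdd) :=
    (isCompact_range (continuous_toAdd.comp (rescale κ₀ a hdiv).continuous)).isClosed
  have hmem : y.toAdd ∈ Set.range fun g : G ↦ (rescale κ₀ a hdiv g).toAdd := by
    refine PadicInt.denseRange_natCast.induction_on y.toAdd hclosed fun n ↦ ⟨γ₀ ^ n, ?_⟩
    change (rescale κ₀ a hdiv (γ₀ ^ n)).toAdd = (n : ℤ_[p])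
    rw [map_pow, rescale_eq_one κ₀ a hdiv γ₀ h, ← ofAdd_nsmul, toAdd_ofAdd, nsmul_eq_mul, mul_one]
  obtain ⟨g, hg⟩ := hmem
  exact ⟨g, Multiplicative.toAdd.injective hg⟩

end Rescale

/-! ## 3. (a) for an arbitrary `κ₀` -/

section Descent

variable {G : Type u} [Group G] [TopologicalSpace G] [IsTopologicalGroup G] [CompactSpace G]
variable {A : Type u} [AddCommGroup A] [DistribMulAction G A] [TopologicalSpace A]
  [DiscreteTopology A]
variable (hA : ∀ a : A, IsOpen {g : G | g • a = a})
variable {p : ℕ} [Fact p.Prime] (κ₀ : G →ₜ* Multiplicative ℤ_[p]) (hAt : IsPrimaryTorsion p A)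

/-- The "identity" `G → ker κ₀` when `κ₀` is trivial. [folklore] -/
def toKerOfTrivial (h : ∀ g : G, κ₀ g = 1) : G →ₜ* (kerK κ₀ : Subgroup G) where
  toFun g := ⟨g, (MonoidHom.mem_ker).mpr (h g)⟩
  map_one' := rfl
  map_mul' _ _ := rfl
  continuous_toFun := continuous_id.subtype_mk _

omit [CompactSpace G] in
/-- Restriction along a subgroup inclusion followed by restriction along equal subgroups is the
restriction (`resH1Hom_comp`). [folklore] -/
theorem resOfLe_comp_resSubgroup {H H' : Subgroup G} (h : H ≤ H') :
    (resOfLe A h).comp (ResKernel.resSubgroup H' A) = ResKernel.resSubgroup H A := by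
  rw [resOfLe, ResKernel.resSubgroup, ResKernel.resSubgroup, resH1Hom_comp]
  exact resH1Hom_congr (ContinuousMonoidHom.ext fun _ ↦ rfl) (AddMonoidHom.ext fun _ ↦ rfl) _ _

omit [CompactSpace G] in
/-- `res_{H ≤ H} ∘ res_{H ≤ H'}`-type round trip along an EQUALITY of subgroups is the identity.
[folklore] -/
theorem resOfLe_resOfLe_of_eq {H H' : Subgroup G} (e : H = H') (x : subgroupH1 H' A) :
    resOfLe A e.ge (resOfLe A e.le x) = x := by
  rw [← AddMonoidHom.comp_apply, resOfLe_comp_holds, resOfLe_refl_holds, AddMonoidHom.id_apply]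

include hA hAt in
/-- **(a) for an arbitrary continuous `κ₀ : G → ℤ_p`: `H¹(G, A) ↠ H¹(ker κ₀, A)^{G}`.**  For a
profinite `G`, a `p`-primary discrete `G`-module `A` with continuous orbit maps and ANY continuous
homomorphism `κ₀ : G → ℤ_p`, every class `x ∈ H¹(ker κ₀, A)` with `conj_g x = x` for all `g ∈ G`
is `res z` for some `z ∈ H¹(G, A)`.  If `κ₀ = 0` then `ker κ₀ = G` and `z = x`; otherwise
`κ₀(G) = p^a ℤ_p` (`imageIdeal_eq_bot_or`), `rescale κ₀ a : G ↠ ℤ_p` has the same kernel and a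
`γ₀` with value `1`, and (a) (`exists_resSubgroup_eq_of_conjH1_eq`) applies.  (JSW17: "the maps
`H¹(K_w, W) → H¹(K_w, M)^Γ` are surjective", at a place `w` finitely or infinitely decomposed in
`K_∞`.) [cite: JetchevSkinnerWan2017, Lemma 3.3.3 (arXiv:1512.06894 p. 12)]
[cite: SerreGaloisCohomology1997, I §2.6 (b)] -/
theorem exists_resSubgroup_eq_of_forall_conjH1_eq [T2Space G] [TotallyDisconnectedSpace G]
    (x : subgroupH1 (kerK κ₀) A) (hx : ∀ g : G, conjH1 (kerK κ₀) A g x = x) :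
    ∃ z : discreteH1 G A, ResKernel.resSubgroup (kerK κ₀) A z = x := by
  rcases imageIdeal_eq_bot_or κ₀ with h0 | ⟨a, γ₀, hγ₀, hdiv⟩
  · -- `κ₀` trivial: `ker κ₀ = G`
    refine ⟨resH1Hom (toKerOfTrivial κ₀ h0) (AddMonoidHom.id A) (fun _ _ ↦ rfl) x, ?_⟩
    rw [ResKernel.resSubgroup, ← AddMonoidHom.comp_apply, resH1Hom_comp]
    have e : resH1Hom ((toKerOfTrivial κ₀ h0).comp
        (Literature.NumberTheory.EllipticCurves.subgroupIncl (kerK κ₀)))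
        ((AddMonoidHom.id A).comp (AddMonoidHom.id A)) (fun _ _ ↦ rfl) =
        resH1Hom (ContinuousMonoidHom.id _) (AddMonoidHom.id A) (fun _ _ ↦ rfl) :=
      resH1Hom_congr (ContinuousMonoidHom.ext fun _ ↦ rfl) (AddMonoidHom.ext fun _ ↦ rfl) _ _
    rw [e, resH1Hom_id, AddMonoidHom.id_apply]
  · -- `κ₀(G) = p^a ℤ_p`: rescale and apply (a)
    have hsurj := rescale_surjective κ₀ a hdiv γ₀ hγ₀
    have hone := rescale_eq_one κ₀ a hdiv γ₀ hγ₀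
    have e : kerK (rescale κ₀ a hdiv) = kerK κ₀ := kerK_rescale κ₀ a hdiv
    -- transport `x` to `H¹(ker (rescale κ₀ a), A)`
    set x' : subgroupH1 (kerK (rescale κ₀ a hdiv)) A := resOfLe A e.le x with hx'
    have hx'inv : conjH1 (kerK (rescale κ₀ a hdiv)) A γ₀ x' = x' := by
      rw [hx', ← AddMonoidHom.comp_apply, ← resOfLe_comp_conjH1_holds (M := A) e.le γ₀,
        AddMonoidHom.comp_apply, hx γ₀]
    obtain ⟨z, hz⟩ :=
      exists_resSubgroup_eq_of_conjH1_eq hA γ₀ (rescale κ₀ a hdiv) hsurj hone hAt x' hx'inv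
    refine ⟨z, ?_⟩
    rw [← resOfLe_comp_resSubgroup (A := A) e.ge, AddMonoidHom.comp_apply, hz, hx',
      resOfLe_resOfLe_of_eq (A := A) e]

end Descent

end Summit.BirchSwinnertonDyer.Rank1Residual.X11b.ProcyclicDescent

end
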